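import Summits.FinalStateConjecture.FinalStateConjecture.Theses.ZeroEnergyKerrOrBomb
import Summits.FinalStateConjecture.FinalStateConjecture.Theorems.ZeroEnergyRigidity.Negative.HorizonKillingScaling
import Literature.Geometry.Lorentzian.AxisymmetricBlackHoleUniqueness
import Literature.Geometry.Lorentzian.KillingAlgebraAsymptoticallyFlat

/-!
# `ZeroEnergyRigidity`, line `global-horizon-killing-field` — stub `stub_rotatingUniqueness_of`

Crux `stmt-FinalStateConjecture-10690` (`Theses.ZeroEnergyKerrOrBomb.ZeroEnergyRigidity`), the
ROTATING endgame (S3) of the lead's skeleton, in its registered conditional form: the two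
published theorems it rests on are the Literature named facts
`ChruscielCostaHeusler2012_axisymmetricUniqueness` (CCH12 Thm. 3.2,
`AxisymmetricBlackHoleUniqueness.lean`) and `BeigChrusciel1997_axisymmetricCombination`
(Beig–Chruściel 1997 Thm. 1.2 as used in CCH12 §3.2.1, `KillingAlgebraAsymptoticallyFlat.lean`);
they enter as HYPOTHESES, so the theorem below is unconditional and sorry-free.

Statement proved (`stub_rotatingUniqueness_of`): the two facts imply the rigidity schema
`AlexakisIonescuKlainermanRigidity` at the class "`I⁺`-regular, connected horizon, and a second
Killing field `K` on the whole carrier which is complete, commutes with `T`, is nowhere zero on and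
tangent to `𝓔⁺`, satisfies `∇_K K = κ K` there with `κ ≠ 0`, and is not a constant multiple of `T`"
(rotating, non-degenerate).

Proof (Chruściel–Costa–Heusler 2012, §3.2.1 and Thm. 3.2): Beig–Chruściel produce `a T + b K`
(`b ≠ 0`) complete with `2π`-periodic orbits and non-empty axis; the glue lemmas below (sums and
multiples of Killing fields are Killing — O'Neill 1983 Ch. 9; bilinearity of the Lie bracket —
O'Neill 1983 Ch. 1 Lemma 18) make it an axisymmetric Killing field commuting with `T`
(`Spacetime.IsAxisymmetricKilling`, Heusler 1996 Def. 2.6), i.e. the presentation is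
stationary–axisymmetric, and CCH12 Thm. 3.2 (`ChruscielCostaHeusler2012_axisymmetricUniqueness.apply`)
concludes.

References: R. Beig, P. T. Chruściel, Commun. Math. Phys. 188 (1997) 585, Thm. 1.2;
P. T. Chruściel, J. L. Costa, M. Heusler, Living Rev. Relativity 15 (2012) 7, §3.2.1, Thm. 3.2;
B. O'Neill, *Semi-Riemannian Geometry* (1983), Ch. 1 Lemma 18, Ch. 9 Prop. 9.25.
-/

noncomputable section

-- summit = problem name (D-0017)
set_option linter.dupNamespace false

namespace Summit.FinalStateConjecture.FinalStateConjecture.Theorems.ZeroEnergyRigidity.GlobalHorizonKillingField.RotatingUniqueness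

open Set Function Literature.Geometry.Lorentzian
open scoped Manifold ContDiff Topology

section Glue

variable (𝓑 : StationaryAFBlackHole.{0}) [𝓑.metric.HasLeviCivita]

/-- **Sums of Killing fields are Killing fields**: `∇(V + W) = ∇V + ∇W`
(`IsCovariantDerivativeOn.add` at the `C^∞` sections `V`, `W`) and the Killing equation is
linear. O'Neill 1983, Ch. 9, Prop. 9.25 and remark (1) before Lemma 9.28 ("any linear
combination of Killing fields (coefficients constant) is again a Killing field"). -/
theorem isKillingField_add {V W : Π x : 𝓑.carrier, TangentSpace (𝓡 4) x}
    (hV : 𝓑.metric.IsKillingField V) (hW : 𝓑.metric.IsKillingField W) :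
    𝓑.metric.IsKillingField (V + W) := by
  refine ⟨hV.contMDiff.add_section hW.contMDiff, fun x Y₀ Z₀ ↦ ?_⟩
  have hVx : MDifferentiableAt (𝓡 4) (𝓡 4).tangent
      (fun y ↦ (⟨y, V y⟩ : TangentBundle (𝓡 4) 𝓑.carrier)) x :=
    (hV.contMDiff x).mdifferentiableAt (by simp)
  have hWx : MDifferentiableAt (𝓡 4) (𝓡 4).tangent
      (fun y ↦ (⟨y, W y⟩ : TangentBundle (𝓡 4) 𝓑.carrier)) x :=
    (hW.contMDiff x).mdifferentiableAt (by simp)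
  have hs : 𝓑.metric.leviCivita (V + W) x =
      𝓑.metric.leviCivita V x + 𝓑.metric.leviCivita W x :=
    𝓑.metric.leviCivita.isCovariantDerivativeOnUniv.add hVx hWx
  have h₁ := hV.val_leviCivita_add x Y₀ Z₀
  have h₂ := hW.val_leviCivita_add x Y₀ Z₀
  simp only [hs, add_apply, map_add]
  linear_combination h₁ + h₂

/-- **Linear combinations `a • V + b • W` of Killing fields are Killing fields** (with the landed
`Negative.isKillingField_const_smul`). O'Neill 1983, Ch. 9, remark (1) before Lemma 9.28. -/
theorem isKillingField_combination {V W : Π x : 𝓑.carrier, TangentSpace (𝓡 4) x}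
    (hV : 𝓑.metric.IsKillingField V) (hW : 𝓑.metric.IsKillingField W) (a b : ℝ) :
    𝓑.metric.IsKillingField (a • V + b • W) :=
  isKillingField_add 𝓑 (Negative.isKillingField_const_smul 𝓑 hV a)
    (Negative.isKillingField_const_smul 𝓑 hW b)

/-- **`[T, a T + b K] = 0` when `[T, K] = 0`**: bilinearity of the Lie bracket of vector fields
(Mathlib `VectorField.mlieBracket_add_right`, `mlieBracket_const_smul_right`, at the `C^∞` hence
differentiable sections `T`, `K`) and `[T, T] = 0` (`mlieBracket_self`). O'Neill 1983, Ch. 1,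
Lemma 18 (pp. 13–14: the bracket is `ℝ`-bilinear and skew, `[V, V] = 0`). -/
theorem mlieBracket_killing_combination {K : Π x : 𝓑.carrier, TangentSpace (𝓡 4) x}
    (hK : 𝓑.metric.IsKillingField K)
    (hcomm : ∀ x, VectorField.mlieBracket (𝓡 4) 𝓑.killing K x = 0) (a b : ℝ) (x : 𝓑.carrier) :
    VectorField.mlieBracket (𝓡 4) 𝓑.killing (a • 𝓑.killing + b • K) x = 0 := by
  have hT : 𝓑.metric.IsKillingField 𝓑.killing := 𝓑.isStationaryKilling.isKillingField
  have hTx : MDifferentiableAt (𝓡 4) (𝓡 4).tangent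
      (fun y ↦ (⟨y, 𝓑.killing y⟩ : TangentBundle (𝓡 4) 𝓑.carrier)) x :=
    (hT.contMDiff x).mdifferentiableAt (by simp)
  have hKx : MDifferentiableAt (𝓡 4) (𝓡 4).tangent
      (fun y ↦ (⟨y, K y⟩ : TangentBundle (𝓡 4) 𝓑.carrier)) x :=
    (hK.contMDiff x).mdifferentiableAt (by simp)
  rw [VectorField.mlieBracket_add_right hTx.smul_const_section hKx.smul_const_section,
    VectorField.mlieBracket_const_smul_right hTx, VectorField.mlieBracket_const_smul_right hKx,
    VectorField.mlieBracket_self, hcomm x]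
  simp

omit [𝓑.metric.HasLeviCivita] in
/-- **`a T + b K ≢ 0` when `b ≠ 0` and `K ∉ ℝT`**: if `a T + b K` vanished identically then
`K = (-(a / b)) • T`. (Linear algebra.) -/
theorem exists_apply_ne_zero_of_not_smul {K : Π x : 𝓑.carrier, TangentSpace (𝓡 4) x}
    (hrot : ¬ ∃ c : ℝ, K = c • 𝓑.killing) {a b : ℝ} (hb : b ≠ 0) :
    ∃ x, (a • 𝓑.killing + b • K) x ≠ 0 := by
  by_contra h
  push Not at h
  refine hrot ⟨-(a / b), funext fun x ↦ ?_⟩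
  have hx : b • K x = -(a • 𝓑.killing x) := by
    rw [eq_neg_iff_add_eq_zero, add_comm]
    simpa using h x
  calc K x = b⁻¹ • (b • K x) := by rw [smul_smul, inv_mul_cancel₀ hb, one_smul]
    _ = (-(a / b)) • 𝓑.killing x := by
      rw [hx, smul_neg, smul_smul, ← neg_smul]
      congr 1
      ring

/-- **The Beig–Chruściel combination is an axisymmetric Killing field commuting with `T`**: from
the named fact's output (`b ≠ 0`, completeness, `2π`-periodic orbits, non-empty axis) and the glue
above, `Y = a T + b K` satisfies `Spacetime.IsAxisymmetricKilling Y` (Heusler 1996, Def. 2.6) and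
`[T, Y] = 0`, i.e. `𝓑.IsStationaryAxisymmetric`'s witness. Chruściel–Costa–Heusler 2012, §3.2.1
(p. 10). -/
theorem isAxisymmetricKilling_combination {K : Π x : 𝓑.carrier, TangentSpace (𝓡 4) x}
    (hK : 𝓑.metric.IsKillingField K)
    (hcomm : ∀ x, VectorField.mlieBracket (𝓡 4) 𝓑.killing K x = 0)
    (hrot : ¬ ∃ c : ℝ, K = c • 𝓑.killing) {a b : ℝ} (hb : b ≠ 0)
    (hc : IsCompleteVectorField (a • 𝓑.killing + b • K))
    (hper : ∀ γ : ℝ → 𝓑.carrier, IsMIntegralCurve γ (a • 𝓑.killing + b • K) →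
      Function.Periodic γ (2 * Real.pi))
    (haxis : ∃ x, (a • 𝓑.killing + b • K) x = 0) :
    𝓑.toSpacetime.IsAxisymmetricKilling (a • 𝓑.killing + b • K) ∧
      ∀ x, VectorField.mlieBracket (𝓡 4) 𝓑.killing (a • 𝓑.killing + b • K) x = 0 :=
  ⟨⟨isKillingField_combination 𝓑 𝓑.isStationaryKilling.isKillingField hK a b, hc, hper,
      exists_apply_ne_zero_of_not_smul 𝓑 hrot hb, haxis⟩,
    mlieBracket_killing_combination 𝓑 hK hcomm a b⟩

end Glue

/-- **Registered stub `stub_rotatingUniqueness_of` (S3, conditional form).**  CCH12 Thm. 3.2 and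
the Beig–Chruściel combination imply the rigidity schema at "`I⁺`-regular, connected horizon,
complete `T`-commuting second Killing field null-generating `𝓔⁺` with `κ ≠ 0`, `K ∉ ℝT`".
Chruściel–Costa–Heusler 2012, §3.2.1 and Thm. 3.2. -/
theorem stub_rotatingUniqueness_of :
    ChruscielCostaHeusler2012_axisymmetricUniqueness.{0} →
    BeigChrusciel1997_axisymmetricCombination.{0} →
    AlexakisIonescuKlainermanRigidity.{0} fun 𝓑 ↦ 𝓑.IsIPlusRegular ∧ IsConnected 𝓑.horizon ∧
      ∀ [𝓑.metric.HasLeviCivita], ∃ K : Π x : 𝓑.carrier, TangentSpace (𝓡 4) x,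
        𝓑.metric.IsKillingField K ∧ IsCompleteVectorField K ∧
        (∀ x, VectorField.mlieBracket (𝓡 4) 𝓑.killing K x = 0) ∧
        (∀ p ∈ 𝓑.horizon, K p ≠ 0) ∧
        (∀ γ : ℝ → 𝓑.carrier, IsMIntegralCurve γ K → γ 0 ∈ 𝓑.horizon → ∀ t, γ t ∈ 𝓑.horizon) ∧
        (∃ κ : ℝ, κ ≠ 0 ∧ ∀ p ∈ 𝓑.horizon, 𝓑.metric.leviCivita K p (K p) = κ • K p) ∧
        ¬ ∃ c : ℝ, K = c • 𝓑.killing := by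
  intro hCCH hBC 𝓑 _ _ hF hP hres hpred hvac
  obtain ⟨hreg, hconn, hK⟩ := hpred
  obtain ⟨K, hK, hKc, hcomm, hne, htan, hκ, hrot⟩ := hK
  have hnd : 𝓑.IsIPlusRegularNonDegenerate := ⟨hreg, hconn, fun {_} ↦ ⟨K, hK, hne, htan, hκ⟩⟩
  obtain ⟨a, b, hb, hc, hper, haxis⟩ := hBC 𝓑 hnd hvac K hK hKc hcomm hrot
  obtain ⟨hY, hTY⟩ := isAxisymmetricKilling_combination 𝓑 hK hcomm hrot hb hc hper haxis
  exact hCCH.apply 𝓑 hF hP hres hreg hconn (fun {_} ↦ ⟨K, hK, hne, htan, hκ⟩)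
    (a • 𝓑.killing + b • K) hY hTY hvac

end Summit.FinalStateConjecture.FinalStateConjecture.Theorems.ZeroEnergyRigidity.GlobalHorizonKillingField.RotatingUniqueness

end
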